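import Literature.RingTheory.CohomologyAnnihilator.TowerSyzygy
import Literature.RingTheory.CohomologyAnnihilator.NoetherDifferentAnnihilator
import Mathlib.Algebra.Module.Torsion.Basic
import HarnessLib

/-!
# The tower `|G|ₙ` under restriction of scalars; change of generator

Topic: `Literature/RingTheory/CohomologyAnnihilator`. Folklore bookkeeping for the Dao–Takahashi
induction [IyengarTakahashi2014, Theorems 5.1, 5.2] ("viewing `G` as an `R`-module, it follows
that `N/aN` is in `|G|ₙ`"): along an algebra `R → S` the restriction of scalars
`mod S → mod R` (`restrictScalarsFunctor R S`) maps `add G` into `add G|_R` and `|G|ₙ` into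
`|G|_R|ₙ` (`IsRetractOfPower.restrictScalars`, `InTower.restrictScalars`); enlarging the
generator (`IsRetractOfPower.of_isRetractOfPower_gen`, `InTower.mono_gen`); zero modules as
syzygies (`isSyzygy_punit_of_isZero`); and, for `S = R ⧸ I`, the identification of an
`I`-torsion `R`-module with the restriction of the `R ⧸ I`-module it carries
(`exists_iso_restrictScalars_of_isTorsionBySet`).

## References

* S. B. Iyengar, R. Takahashi, *Annihilation of cohomology and strong generation of module
  categories*, IMRN 2016; arXiv:1404.1476 — proof of Theorem 5.1. [`IyengarTakahashi2014`]
-/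

noncomputable section

open CategoryTheory CategoryTheory.Limits

universe u

namespace Literature.RingTheory.CohomologyAnnihilator

/-! ## Change of generator -/

section Gen

variable {A : Type u} [CommRing A]

/-- `add` is transitive: if `G ∈ add G'` and `X ∈ add G` then `X ∈ add G'`. [folklore] -/
theorem IsRetractOfPower.of_isRetractOfPower_gen {G G' X : ModuleCat.{u} A}
    (hG : IsRetractOfPower G' G) (hX : IsRetractOfPower G X) : IsRetractOfPower G' X := by
  obtain ⟨m, i, p, hip⟩ := hX
  exact (hG.pi m).of_retract i p hip

/-- Enlarging the generator: if `G ∈ add G'` then `|G|ₙ ⊆ |G'|ₙ`. [folklore] -/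
theorem InTower.mono_gen {G G' : ModuleCat.{u} A} (hG : IsRetractOfPower G' G) :
    ∀ {n : ℕ} {M : ModuleCat.{u} A}, InTower G n M → InTower G' n M
  | 0, _, h => h
  | _ + 1, _, ⟨W, Y, X, hY, hX, f, g, w, hS⟩ =>
    ⟨W, Y, X, InTower.mono_gen hG hY, hG.of_isRetractOfPower_gen hX, f, g, w, hS⟩

/-- `G₁ ∈ add (G₁ ⊕ G₂)`. [folklore] -/
theorem isRetractOfPower_fst (G₁ G₂ : ModuleCat.{u} A) :
    IsRetractOfPower (ModuleCat.of A (G₁ × G₂)) G₁ :=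
  (isRetractOfPower_self _).of_retract (ModuleCat.ofHom (LinearMap.inl A G₁ G₂))
    (ModuleCat.ofHom (LinearMap.fst A G₁ G₂))
    (by apply ModuleCat.hom_ext; exact LinearMap.ext fun _ => rfl)

/-- `G₂ ∈ add (G₁ ⊕ G₂)`. [folklore] -/
theorem isRetractOfPower_snd (G₁ G₂ : ModuleCat.{u} A) :
    IsRetractOfPower (ModuleCat.of A (G₁ × G₂)) G₂ :=
  (isRetractOfPower_self _).of_retract (ModuleCat.ofHom (LinearMap.inr A G₁ G₂))
    (ModuleCat.ofHom (LinearMap.snd A G₁ G₂))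
    (by apply ModuleCat.hom_ext; exact LinearMap.ext fun _ => rfl)

/-- A zero module is an `s`-th syzygy of a zero module, for every `s`. [folklore] -/
theorem isSyzygy_punit_of_isZero {M : ModuleCat.{u} A} (hM : IsZero M) :
    ∀ s : ℕ, IsSyzygy s M (ModuleCat.of A PUnit.{u + 1})
  | 0 => ⟨(ModuleCat.isZero_of_subsingleton _).iso hM⟩
  | s + 1 => isSyzygy_succ_iff_exists_first.mpr ⟨ModuleCat.of A PUnit.{u + 1},
      isSyzygy_one_of_isZero hM (ModuleCat.isZero_of_subsingleton _),
      isSyzygy_punit_of_isZero (ModuleCat.isZero_of_subsingleton _) s⟩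

end Gen

/-! ## Restriction of scalars -/

section Restrict

variable {R S : Type u} [CommRing R] [CommRing S] [Algebra R S]

/-- `(Gᵐ)|_R ≅ (G|_R)ᵐ` (the identity map). [folklore] -/
theorem nonempty_restrictScalars_pi_iso (G : ModuleCat.{u} S) (m : ℕ) :
    Nonempty ((restrictScalarsFunctor R S).obj (ModuleCat.of S (Fin m → G)) ≅
      ModuleCat.of R (Fin m → (restrictScalarsFunctor R S).obj G)) :=
  letI : Module R (Fin m → G) :=
    ((restrictScalarsFunctor R S).obj (ModuleCat.of S (Fin m → G))).isModule
  ⟨LinearEquiv.toModuleIso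
    { toFun := fun x => x
      map_add' := fun _ _ => rfl
      map_smul' := fun _ _ => rfl
      invFun := fun x => x
      left_inv := fun _ => rfl
      right_inv := fun _ => rfl }⟩

/-- `(M ⊕ W)|_R ≅ M|_R ⊕ W|_R` (the identity map). [folklore] -/
theorem nonempty_restrictScalars_prod_iso (M W : ModuleCat.{u} S) :
    Nonempty ((restrictScalarsFunctor R S).obj (ModuleCat.of S (M × W)) ≅
      ModuleCat.of R ((restrictScalarsFunctor R S).obj M × (restrictScalarsFunctor R S).obj W)) :=
  letI : Module R (M × W) := ((restrictScalarsFunctor R S).obj (ModuleCat.of S (M × W))).isModule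
  ⟨LinearEquiv.toModuleIso
    { toFun := fun x => x
      map_add' := fun _ _ => rfl
      map_smul' := fun _ _ => rfl
      invFun := fun x => x
      left_inv := fun _ => rfl
      right_inv := fun _ => rfl }⟩

/-- Restriction of scalars maps `add G` into `add G|_R`. [folklore] -/
theorem IsRetractOfPower.restrictScalars {G X : ModuleCat.{u} S} (h : IsRetractOfPower G X) :
    IsRetractOfPower ((restrictScalarsFunctor R S).obj G) ((restrictScalarsFunctor R S).obj X) := by
  obtain ⟨m, i, p, hip⟩ := h
  obtain ⟨ε⟩ := nonempty_restrictScalars_pi_iso (R := R) G m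
  refine ⟨m, (restrictScalarsFunctor R S).map i ≫ ε.hom, ε.inv ≫ (restrictScalarsFunctor R S).map p,
    ?_⟩
  rw [Category.assoc, ε.hom_inv_id_assoc, ← CategoryTheory.Functor.map_comp, hip,
    CategoryTheory.Functor.map_id]

/-- Restriction of scalars maps `|G|ₙ` into `|G|_R|ₙ` (it is exact and additive).
[cite: IyengarTakahashi2014, Thm. 5.1 (proof)] -/
theorem InTower.restrictScalars {G : ModuleCat.{u} S} :
    ∀ {n : ℕ} {M : ModuleCat.{u} S}, InTower G n M →
      InTower ((restrictScalarsFunctor R S).obj G) n ((restrictScalarsFunctor R S).obj M)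
  | 0, _, h => (restrictScalarsFunctor R S).map_isZero h
  | n + 1, M, ⟨W, Y, X, hY, hX, f, g, w, hS⟩ => by
    obtain ⟨ε⟩ := nonempty_restrictScalars_prod_iso (R := R) M W
    have hS' := hS.map_of_exact (restrictScalarsFunctor R S)
    obtain ⟨w', hS''⟩ := shortExact_comp_iso (f := (restrictScalarsFunctor R S).map f)
      (g := (restrictScalarsFunctor R S).map g) (w := by
        rw [← CategoryTheory.Functor.map_comp, w, CategoryTheory.Functor.map_zero]) hS' ε
    exact ⟨_, _, _, InTower.restrictScalars hY, hX.restrictScalars, _, _, w', hS''⟩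

/-- Along a surjective `R → S`, finitely generated `S`-modules restrict to finitely generated
`R`-modules. [folklore] -/
theorem finite_restrictScalars_of_surjective (hRS : Function.Surjective (algebraMap R S))
    (M : ModuleCat.{u} S) [Module.Finite S M] :
    Module.Finite R ((restrictScalarsFunctor R S).obj M) := by
  haveI : Module.Finite R S := Module.Finite.of_surjective (Algebra.linearMap R S) hRS
  exact finite_restrictScalars M

end Restrict

/-! ## Modules over a quotient ring -/

section Quotient

variable {R : Type u} [CommRing R] (I : Ideal R)

/-- An `I`-torsion `R`-module `X` is (isomorphic, by the identity, to) the restriction of scalars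
of the `R ⧸ I`-module structure it carries (`Module.IsTorsionBySet.module`). [folklore] -/
theorem nonempty_iso_restrictScalars_of_isTorsionBySet (X : Type u) [AddCommGroup X] [Module R X]
    (hX : Module.IsTorsionBySet R X I) :
    letI := hX.module
    Nonempty ((restrictScalarsFunctor R (R ⧸ I)).obj (ModuleCat.of (R ⧸ I) X) ≅ ModuleCat.of R X) :=
  letI := hX.module
  ⟨LinearEquiv.toModuleIso
    { toFun := fun x => x
      map_add' := fun _ _ => rfl
      map_smul' := fun _ _ => rfl
      invFun := fun x => x
      left_inv := fun _ => rfl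
      right_inv := fun _ => rfl }⟩

/-- A finitely generated `I`-torsion `R`-module is finitely generated over `R ⧸ I`. [folklore] -/
theorem finite_of_isTorsionBySet (X : Type u) [AddCommGroup X] [Module R X] [Module.Finite R X]
    (hX : Module.IsTorsionBySet R X I) :
    letI := hX.module
    Module.Finite (R ⧸ I) X := by
  letI := hX.module
  haveI : IsScalarTower R (R ⧸ I) X := hX.isScalarTower
  exact Module.Finite.of_restrictScalars_finite R (R ⧸ I) X

end Quotient

end Literature.RingTheory.CohomologyAnnihilator

end
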